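import Literature.MathematicalPhysics.QuantumFieldTheory.Balaban1983to89.Node00.Record13CarriersXPinned

/-!
# NODE 00 (YM-PLAN Track A) — THE STAGE-13 CARRIER PINS AT THE v1.2 PROVISOS: `Provisos₁₃Core` (bg-free) and `Provisos₁₃Sep` (row P11 on print's separated
# sequences) TRANSPORT ALONG EVERY `X`-RE-BINDING AND EVERY PIN, the datums `datumOfRecord₁₃Core ∕ datumOfRecord₁₃Sep` ARE UP-SIDE (`rfl`), and the v1.2 record
# `IsRecordOfRecord₁₃CSep` is presented at any re-bound ∕ [B10]-pinned ∕ X-pinned Stage-13 view — the rev-18 twin leaf of `Record13Carriers` §1–§3, `Record13CarriersB13` §1,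
# `Record13CarriersXPinned` §1∕§3 under def-T's token map `Provisos₁₃ ↦ Provisos₁₃Sep`, `datumOfRecord₁₃ ↦ datumOfRecord₁₃Sep`, `IsRecordOfRecord₁₃C ↦ IsRecordOfRecord₁₃CSep`
# (seat `pub-ymgap-dag-n10-d` g7, the ₁₃ carriers' declarer of record — dag-lead WORDS-130 ∕ TRIGGER ROLL-CALL 05:31Z «n10-d — X-view carriers at Sep»; RR-2's re-key order: def-T v1.2 → THIS LEAF → n22-e → n20-d → n17-c → n27-c → readers)

NODE 00 RECORD MODULE at Stage 13, v1.2 vocabulary (node00-def-T g12 `Node00/Record13.lean` v1.2 = p501191 ✓, 05:29Z 2026-08-27, DEPRECATE-AND-ADD per director-ym №138: NEW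
`structure Stage13Params.Provisos₁₃Core` (the nine non-`bg` rows) and FLAT `structure Stage13Params.Provisos₁₃Sep` (the ten rows, `bg` := def-R's ranged `BgProvisoΛ` over the
SEPARATED support `suppOfRecord₁₃Sep` with the run guard `PartCompat₁₃`), one-way maps `Provisos₁₃.toSep ∕ .toCore`, `Provisos₁₃Sep.toCore`, datums `datumOfRecord₁₃Core ∕
datumOfRecord₁₃Sep` (`datumOfRecord₁₃Sep θ h := datumOfRecord₁₃Core θ h.toCore` by `rfl`; every v1.1 datum is a v1.2 datum, `datumOfRecord₁₃Sep_toSep`), record predicate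
`IsRecordOfRecord₁₃CSep` (+ `isRecordOfRecord₁₃CSep_of_eq`, `exists_world_isRecordOfRecord₁₃CSep`, `IsRecordOfRecord₁₃C.toSep`); every v1.1 name UNCHANGED).  THIS LEAF supplies, for
the rev-18 (⁗) consumers that bind worlds at PINNED Stage-13 views (dag-n24-c's K1 engine 36–44, dag-n08-c's N08 storeys, dag-n22-e's layer B, this seat's N10 storeys, …), exactly
the carrier-side faces they read today under the old names: (i) `Provisos₁₃Core.rebindX ∕ .pin<G>` and `Provisos₁₃Sep.rebindX ∕ .pin<G>` for `<G>` ∈ {B10, Y, Z, W, B8, B12,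
B8Sub, B13, X3} — FIELD BY FIELD: the nine ∕ ten rows read `ν`, `τ9`, `ζ`, `ppSel`, `A₁`, `Rz`, `Zt`, `γ`, `gOfRecord₁₃`, `EOfRecord₁₃`, `wOfRecord₉`, `settingOfRecord₁₃`,
`suppOfRecord₁₃Sep`, `UbgOfRecord₁₃`, `PartCompat₁₃`, never `res.X ∕ Y ∕ Z ∕ W`; (ii) `datumOfRecord₁₃Core_rebindX ∕ _pin<G>` and `datumOfRecord₁₃Sep_rebindX ∕ _pin<G>` — ALL
`rfl`: THE PINS ARE UP-SIDE at the v1.2 datums exactly as at the v1.1 datum; (iii) the v1.2 record at a re-bound view: `isRecordOfRecord₁₃CSep_rebindX_of_eq ∕ _pinB10_of_eq ∕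
_pinB13_of_eq ∕ _pinX3_of_eq`, `exists_world_isRecordOfRecord₁₃CSep_rebindX ∕ _pinX3`.  The [B8″] pin `Stage13Params.pinB8SubB` (dag-n05-d `Record13CarriersB8SubB`) is an instance
of `rebindX` too — its named `Sep` faces are that lineage's to declare (one line each through `Provisos₁₃Sep.rebindX` ∕ `datumOfRecord₁₃Sep_rebindX`).  APPEND-ONLY: a NEW
importing leaf (`Record13CarriersXPinned` ⊇ `…B13` ⊇ `Record13Carriers` ⊇ `Record13` v1.2); NOTHING in those files is edited; the v1.1-keyed faces stand verbatim for the ‴ asides.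
[Balaban1988Convergent] = Commun. Math. Phys. **119** (1988) 243–285; [Balaban1989LargeFieldII] = Commun. Math. Phys. **122** (1989) 355–392.

HONEST FRAMING: kernel bookkeeping (structure-instance re-keying and `rfl`); NO estimate; nothing of Bałaban's asserted; the provisos are HYPOTHESIS-SIDE structures, never
admissibility clauses, never inhabited here; no node discharged; counts unmoved (typed 28∕28 · discharged 5∕27); one finite T⁴ programme at fixed ε — NOT continuum ∕ ℝ⁴ ∕ OS ∕
mass gap ∕ Clay.  No `sorry`, no `axiom`, no `def`, no `instance`, no `notation`.
-/

noncomputable section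

namespace Literature.MathematicalPhysics.QuantumFieldTheory.Balaban1983to89.Node00

open T4Continuum AveragingRT T4FiniteEpsInhabited FlowStep FlowStepRuns DagBinding T4DatumAssembly
open scoped Matrix.Norms.L2Operator

variable {F : T4Family} {N : ℕ} [NeZero N]

/-! ## §1. The bg-free CORE provisos transport along every X-re-binding and every pin (field by field: no row reads a carrier) -/

section Core

/-- **The v1.2 core provisos read no carrier**: they transport along ANY `X`-re-binding (nine rows, field by field). [cite: Balaban1988Convergent, (2.18) p.257, (2.21) p.258, (3.2)–(3.9) pp.265–266 (bookkeeping)] -/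
theorem Stage13Params.Provisos₁₃Core.rebindX {θ : Stage13Params F N} (h : θ.Provisos₁₃Core F N) (X' : B12.RunParams → PrintedCarriersR) :
    (θ.rebindX F N X').Provisos₁₃Core F N :=
  { intPiece := h.intPiece, measω := h.measω, measChi := h.measChi, zetaUnity := h.zetaUnity, zetaAbs := h.zetaAbs, rstep := h.rstep,
    rzLaws := h.rzLaws, ztLaws := h.ztLaws, ztLocal := h.ztLocal }

/-- … along the [B10] pin … [cite: Balaban1988Convergent, (2.18) p.257 (bookkeeping)] -/
theorem Stage13Params.Provisos₁₃Core.pinB10 {θ : Stage13Params F N} (h : θ.Provisos₁₃Core F N) : (θ.pinB10 F N).Provisos₁₃Core F N :=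
  h.rebindX _

/-- … the Y pin … [cite: Balaban1988Convergent, (2.18) p.257 (bookkeeping)] -/
theorem Stage13Params.Provisos₁₃Core.pinY {θ : Stage13Params F N} (h : θ.Provisos₁₃Core F N) (Y₀ : PrintedCarriers9X) : (θ.pinY F N Y₀).Provisos₁₃Core F N :=
  { intPiece := h.intPiece, measω := h.measω, measChi := h.measChi, zetaUnity := h.zetaUnity, zetaAbs := h.zetaAbs, rstep := h.rstep,
    rzLaws := h.rzLaws, ztLaws := h.ztLaws, ztLocal := h.ztLocal }

/-- … the Z pin … [cite: Balaban1988Convergent, (2.18) p.257 (bookkeeping)] -/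
theorem Stage13Params.Provisos₁₃Core.pinZ {θ : Stage13Params F N} (h : θ.Provisos₁₃Core F N) (Z₀ : PrintedCarriers11) : (θ.pinZ F N Z₀).Provisos₁₃Core F N :=
  { intPiece := h.intPiece, measω := h.measω, measChi := h.measChi, zetaUnity := h.zetaUnity, zetaAbs := h.zetaAbs, rstep := h.rstep,
    rzLaws := h.rzLaws, ztLaws := h.ztLaws, ztLocal := h.ztLocal }

/-- … the W pin … [cite: Balaban1988Convergent, (2.18) p.257 (bookkeeping)] -/
theorem Stage13Params.Provisos₁₃Core.pinW {θ : Stage13Params F N} (h : θ.Provisos₁₃Core F N) (W₀ : B12.RunParams → PrintedCarriers15) :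
    (θ.pinW F N W₀).Provisos₁₃Core F N :=
  { intPiece := h.intPiece, measω := h.measω, measChi := h.measChi, zetaUnity := h.zetaUnity, zetaAbs := h.zetaAbs, rstep := h.rstep,
    rzLaws := h.rzLaws, ztLaws := h.ztLaws, ztLocal := h.ztLocal }

/-- … the [B8] pin … [cite: Balaban1988Convergent, (2.18) p.257 (bookkeeping)] -/
theorem Stage13Params.Provisos₁₃Core.pinB8 {θ : Stage13Params F N} (h : θ.Provisos₁₃Core F N) (lam : ResidB8 θ.toStage3Params) : (θ.pinB8 F N lam).Provisos₁₃Core F N :=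
  h.rebindX _

/-- … the [B12] pin … [cite: Balaban1988Convergent, (2.18) p.257 (bookkeeping)] -/
theorem Stage13Params.Provisos₁₃Core.pinB12 {θ : Stage13Params F N} (h : θ.Provisos₁₃Core F N) (lam : ResidB12 F N θ.τ9.M) : (θ.pinB12 F N lam).Provisos₁₃Core F N :=
  h.rebindX _

/-- … the [B8′] pin … [cite: Balaban1988Convergent, (2.18) p.257 (bookkeeping)] -/
theorem Stage13Params.Provisos₁₃Core.pinB8Sub {θ : Stage13Params F N} (h : θ.Provisos₁₃Core F N) (lam : ResidB8 θ.toStage3Params) : (θ.pinB8Sub F N lam).Provisos₁₃Core F N :=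
  h.rebindX _

/-- … the [B13] pin … [cite: Balaban1988Convergent, (2.18) p.257; Balaban1988RG2Cluster, Lemmas 1–3 pp.9–20 (bookkeeping)] -/
theorem Stage13Params.Provisos₁₃Core.pinB13 {θ : Stage13Params F N} (h : θ.Provisos₁₃Core F N) (lam : B12.RunParams → ResidB13 θ.toStage3Params) :
    (θ.pinB13 F N lam).Provisos₁₃Core F N :=
  h.rebindX _

/-- … and the one-level X-pin of the three carrier groups of record. [cite: Balaban1988Convergent, (2.18) p.257 (bookkeeping)] -/
theorem Stage13Params.Provisos₁₃Core.pinX3 {θ : Stage13Params F N} (h : θ.Provisos₁₃Core F N) (lam8 : ResidB8 θ.toStage3Params) (lam12 : ResidB12 F N θ.τ9.M)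
    (lam13 : B12.RunParams → ResidB13 θ.toStage3Params) : (θ.pinX3 F N lam8 lam12 lam13).Provisos₁₃Core F N :=
  h.rebindX _

variable (F N)

/-- **THE CORE-KEYED DATUM DOES NOT READ THE CARRIER BUNDLE `X`** (`rfl`, once, at a generic re-binding). [cite: Balaban1989LargeFieldII, Thm 1 + (0.1) pp.355–356 (bookkeeping)] -/
theorem datumOfRecord₁₃Core_rebindX (θ : Stage13Params F N) (h : θ.Provisos₁₃Core F N) (X' : B12.RunParams → PrintedCarriersR)
    (h' : (θ.rebindX F N X').Provisos₁₃Core F N) : datumOfRecord₁₃Core F N (θ.rebindX F N X') h' = datumOfRecord₁₃Core F N θ h := rfl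

/-- The [B10] pin is UP-SIDE at the core-keyed datum (`rfl`) … [cite: Balaban1989LargeFieldII, Thm 1 + (0.1) pp.355–356 (bookkeeping)] -/
theorem datumOfRecord₁₃Core_pinB10 (θ : Stage13Params F N) (h : θ.Provisos₁₃Core F N) :
    datumOfRecord₁₃Core F N (θ.pinB10 F N) h.pinB10 = datumOfRecord₁₃Core F N θ h :=
  datumOfRecord₁₃Core_rebindX F N θ h _ h.pinB10

/-- … the Y pin (`rfl`) … [cite: Balaban1989LargeFieldII, Thm 1 + (0.1) pp.355–356 (bookkeeping)] -/
theorem datumOfRecord₁₃Core_pinY (θ : Stage13Params F N) (h : θ.Provisos₁₃Core F N) (Y₀ : PrintedCarriers9X) :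
    datumOfRecord₁₃Core F N (θ.pinY F N Y₀) (h.pinY Y₀) = datumOfRecord₁₃Core F N θ h := rfl

/-- … the Z pin (`rfl`) … [cite: Balaban1989LargeFieldII, Thm 1 + (0.1) pp.355–356 (bookkeeping)] -/
theorem datumOfRecord₁₃Core_pinZ (θ : Stage13Params F N) (h : θ.Provisos₁₃Core F N) (Z₀ : PrintedCarriers11) :
    datumOfRecord₁₃Core F N (θ.pinZ F N Z₀) (h.pinZ Z₀) = datumOfRecord₁₃Core F N θ h := rfl

/-- … the W pin (`rfl`) … [cite: Balaban1989LargeFieldII, Thm 1 + (0.1) pp.355–356 (bookkeeping)] -/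
theorem datumOfRecord₁₃Core_pinW (θ : Stage13Params F N) (h : θ.Provisos₁₃Core F N) (W₀ : B12.RunParams → PrintedCarriers15) :
    datumOfRecord₁₃Core F N (θ.pinW F N W₀) (h.pinW W₀) = datumOfRecord₁₃Core F N θ h := rfl

/-- … the [B8] pin (`rfl`) … [cite: Balaban1989LargeFieldII, Thm 1 + (0.1) pp.355–356 (bookkeeping)] -/
theorem datumOfRecord₁₃Core_pinB8 (θ : Stage13Params F N) (h : θ.Provisos₁₃Core F N) (lam : ResidB8 θ.toStage3Params) :
    datumOfRecord₁₃Core F N (θ.pinB8 F N lam) (h.pinB8 lam) = datumOfRecord₁₃Core F N θ h :=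
  datumOfRecord₁₃Core_rebindX F N θ h _ (h.pinB8 lam)

/-- … the [B12] pin (`rfl`) … [cite: Balaban1989LargeFieldII, Thm 1 + (0.1) pp.355–356 (bookkeeping)] -/
theorem datumOfRecord₁₃Core_pinB12 (θ : Stage13Params F N) (h : θ.Provisos₁₃Core F N) (lam : ResidB12 F N θ.τ9.M) :
    datumOfRecord₁₃Core F N (θ.pinB12 F N lam) (h.pinB12 lam) = datumOfRecord₁₃Core F N θ h :=
  datumOfRecord₁₃Core_rebindX F N θ h _ (h.pinB12 lam)

/-- … the [B8′] pin (`rfl`) … [cite: Balaban1989LargeFieldII, Thm 1 + (0.1) pp.355–356 (bookkeeping)] -/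
theorem datumOfRecord₁₃Core_pinB8Sub (θ : Stage13Params F N) (h : θ.Provisos₁₃Core F N) (lam : ResidB8 θ.toStage3Params) :
    datumOfRecord₁₃Core F N (θ.pinB8Sub F N lam) (h.pinB8Sub lam) = datumOfRecord₁₃Core F N θ h :=
  datumOfRecord₁₃Core_rebindX F N θ h _ (h.pinB8Sub lam)

/-- … the [B13] pin (`rfl`) … [cite: Balaban1989LargeFieldII, Thm 1 + (0.1) pp.355–356 (bookkeeping)] -/
theorem datumOfRecord₁₃Core_pinB13 (θ : Stage13Params F N) (h : θ.Provisos₁₃Core F N) (lam : B12.RunParams → ResidB13 θ.toStage3Params) :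
    datumOfRecord₁₃Core F N (θ.pinB13 F N lam) (h.pinB13 lam) = datumOfRecord₁₃Core F N θ h :=
  datumOfRecord₁₃Core_rebindX F N θ h _ (h.pinB13 lam)

/-- … and the one-level X-pin (`rfl`). [cite: Balaban1989LargeFieldII, Thm 1 + (0.1) pp.355–356 (bookkeeping)] -/
theorem datumOfRecord₁₃Core_pinX3 (θ : Stage13Params F N) (h : θ.Provisos₁₃Core F N) (lam8 : ResidB8 θ.toStage3Params) (lam12 : ResidB12 F N θ.τ9.M)
    (lam13 : B12.RunParams → ResidB13 θ.toStage3Params) :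
    datumOfRecord₁₃Core F N (θ.pinX3 F N lam8 lam12 lam13) (h.pinX3 lam8 lam12 lam13) = datumOfRecord₁₃Core F N θ h :=
  datumOfRecord₁₃Core_rebindX F N θ h _ (h.pinX3 lam8 lam12 lam13)

end Core

/-! ## §2. The SEPARATED-RANGE provisos (row P11 on print's sequences, v1.2) transport along every X-re-binding and every pin; their datum is UP-SIDE -/

section Sep

/-- **The v1.2 separated-range provisos read no carrier**: they transport along ANY `X`-re-binding (ten rows, field by field; row `bg` reads `γ`, `gOfRecord₁₃`,
`PartCompat₁₃`, `settingOfRecord₁₃`, `Rz`, `τ9`, `suppOfRecord₁₃Sep`, `UbgOfRecord₁₃` — never `res.X`). [cite: Balaban1988Convergent, (2.18) p.257, (2.23)–(2.42) pp.259–262, (3.2)–(3.9) pp.265–266; Balaban1985RegularSpaces, (1.3)–(1.6) p.77 (bookkeeping)] -/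
theorem Stage13Params.Provisos₁₃Sep.rebindX {θ : Stage13Params F N} (h : θ.Provisos₁₃Sep F N) (X' : B12.RunParams → PrintedCarriersR) :
    (θ.rebindX F N X').Provisos₁₃Sep F N :=
  { intPiece := h.intPiece, measω := h.measω, measChi := h.measChi, zetaUnity := h.zetaUnity, zetaAbs := h.zetaAbs, rstep := h.rstep,
    rzLaws := h.rzLaws, ztLaws := h.ztLaws, ztLocal := h.ztLocal, bg := h.bg }

/-- … along the [B10] pin … [cite: Balaban1988Convergent, (2.23)–(2.42) pp.259–262 (bookkeeping)] -/
theorem Stage13Params.Provisos₁₃Sep.pinB10 {θ : Stage13Params F N} (h : θ.Provisos₁₃Sep F N) : (θ.pinB10 F N).Provisos₁₃Sep F N :=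
  h.rebindX _

/-- … the Y pin … [cite: Balaban1988Convergent, (2.23)–(2.42) pp.259–262 (bookkeeping)] -/
theorem Stage13Params.Provisos₁₃Sep.pinY {θ : Stage13Params F N} (h : θ.Provisos₁₃Sep F N) (Y₀ : PrintedCarriers9X) : (θ.pinY F N Y₀).Provisos₁₃Sep F N :=
  { intPiece := h.intPiece, measω := h.measω, measChi := h.measChi, zetaUnity := h.zetaUnity, zetaAbs := h.zetaAbs, rstep := h.rstep,
    rzLaws := h.rzLaws, ztLaws := h.ztLaws, ztLocal := h.ztLocal, bg := h.bg }

/-- … the Z pin … [cite: Balaban1988Convergent, (2.23)–(2.42) pp.259–262 (bookkeeping)] -/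
theorem Stage13Params.Provisos₁₃Sep.pinZ {θ : Stage13Params F N} (h : θ.Provisos₁₃Sep F N) (Z₀ : PrintedCarriers11) : (θ.pinZ F N Z₀).Provisos₁₃Sep F N :=
  { intPiece := h.intPiece, measω := h.measω, measChi := h.measChi, zetaUnity := h.zetaUnity, zetaAbs := h.zetaAbs, rstep := h.rstep,
    rzLaws := h.rzLaws, ztLaws := h.ztLaws, ztLocal := h.ztLocal, bg := h.bg }

/-- … the W pin … [cite: Balaban1988Convergent, (2.23)–(2.42) pp.259–262 (bookkeeping)] -/
theorem Stage13Params.Provisos₁₃Sep.pinW {θ : Stage13Params F N} (h : θ.Provisos₁₃Sep F N) (W₀ : B12.RunParams → PrintedCarriers15) :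
    (θ.pinW F N W₀).Provisos₁₃Sep F N :=
  { intPiece := h.intPiece, measω := h.measω, measChi := h.measChi, zetaUnity := h.zetaUnity, zetaAbs := h.zetaAbs, rstep := h.rstep,
    rzLaws := h.rzLaws, ztLaws := h.ztLaws, ztLocal := h.ztLocal, bg := h.bg }

/-- … the [B8] pin … [cite: Balaban1988Convergent, (2.23)–(2.42) pp.259–262 (bookkeeping)] -/
theorem Stage13Params.Provisos₁₃Sep.pinB8 {θ : Stage13Params F N} (h : θ.Provisos₁₃Sep F N) (lam : ResidB8 θ.toStage3Params) : (θ.pinB8 F N lam).Provisos₁₃Sep F N :=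
  h.rebindX _

/-- … the [B12] pin … [cite: Balaban1988Convergent, (2.23)–(2.42) pp.259–262 (bookkeeping)] -/
theorem Stage13Params.Provisos₁₃Sep.pinB12 {θ : Stage13Params F N} (h : θ.Provisos₁₃Sep F N) (lam : ResidB12 F N θ.τ9.M) : (θ.pinB12 F N lam).Provisos₁₃Sep F N :=
  h.rebindX _

/-- … the [B8′] pin … [cite: Balaban1988Convergent, (2.23)–(2.42) pp.259–262 (bookkeeping)] -/
theorem Stage13Params.Provisos₁₃Sep.pinB8Sub {θ : Stage13Params F N} (h : θ.Provisos₁₃Sep F N) (lam : ResidB8 θ.toStage3Params) : (θ.pinB8Sub F N lam).Provisos₁₃Sep F N :=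
  h.rebindX _

/-- … the [B13] pin … [cite: Balaban1988Convergent, (2.23)–(2.42) pp.259–262; Balaban1988RG2Cluster, Lemmas 1–3 pp.9–20 (bookkeeping)] -/
theorem Stage13Params.Provisos₁₃Sep.pinB13 {θ : Stage13Params F N} (h : θ.Provisos₁₃Sep F N) (lam : B12.RunParams → ResidB13 θ.toStage3Params) :
    (θ.pinB13 F N lam).Provisos₁₃Sep F N :=
  h.rebindX _

/-- … and the one-level X-pin of the three carrier groups of record. [cite: Balaban1988Convergent, (2.23)–(2.42) pp.259–262 (bookkeeping)] -/
theorem Stage13Params.Provisos₁₃Sep.pinX3 {θ : Stage13Params F N} (h : θ.Provisos₁₃Sep F N) (lam8 : ResidB8 θ.toStage3Params) (lam12 : ResidB12 F N θ.τ9.M)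
    (lam13 : B12.RunParams → ResidB13 θ.toStage3Params) : (θ.pinX3 F N lam8 lam12 lam13).Provisos₁₃Sep F N :=
  h.rebindX _

variable (F N)

/-- **THE SEPARATED-RANGE DATUM DOES NOT READ THE CARRIER BUNDLE `X`** (`rfl`, once, at a generic re-binding). [cite: Balaban1989LargeFieldII, Thm 1 + (0.1) pp.355–356 (bookkeeping)] -/
theorem datumOfRecord₁₃Sep_rebindX (θ : Stage13Params F N) (h : θ.Provisos₁₃Sep F N) (X' : B12.RunParams → PrintedCarriersR)
    (h' : (θ.rebindX F N X').Provisos₁₃Sep F N) : datumOfRecord₁₃Sep F N (θ.rebindX F N X') h' = datumOfRecord₁₃Sep F N θ h := rfl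

/-- **THE PINS ARE UP-SIDE at the v1.2 datum**: the [B10] pin (`rfl`) … [cite: Balaban1989LargeFieldII, Thm 1 + (0.1) pp.355–356; Balaban1985UV3, Thm 1 p.257 (bookkeeping)] -/
theorem datumOfRecord₁₃Sep_pinB10 (θ : Stage13Params F N) (h : θ.Provisos₁₃Sep F N) :
    datumOfRecord₁₃Sep F N (θ.pinB10 F N) h.pinB10 = datumOfRecord₁₃Sep F N θ h :=
  datumOfRecord₁₃Sep_rebindX F N θ h _ h.pinB10

/-- … the Y pin (`rfl`) … [cite: Balaban1989LargeFieldII, Thm 1 + (0.1) pp.355–356 (bookkeeping)] -/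
theorem datumOfRecord₁₃Sep_pinY (θ : Stage13Params F N) (h : θ.Provisos₁₃Sep F N) (Y₀ : PrintedCarriers9X) :
    datumOfRecord₁₃Sep F N (θ.pinY F N Y₀) (h.pinY Y₀) = datumOfRecord₁₃Sep F N θ h := rfl

/-- … the Z pin (`rfl`) … [cite: Balaban1989LargeFieldII, Thm 1 + (0.1) pp.355–356 (bookkeeping)] -/
theorem datumOfRecord₁₃Sep_pinZ (θ : Stage13Params F N) (h : θ.Provisos₁₃Sep F N) (Z₀ : PrintedCarriers11) :
    datumOfRecord₁₃Sep F N (θ.pinZ F N Z₀) (h.pinZ Z₀) = datumOfRecord₁₃Sep F N θ h := rfl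

/-- … the W pin (`rfl`) … [cite: Balaban1989LargeFieldII, Thm 1 + (0.1) pp.355–356 (bookkeeping)] -/
theorem datumOfRecord₁₃Sep_pinW (θ : Stage13Params F N) (h : θ.Provisos₁₃Sep F N) (W₀ : B12.RunParams → PrintedCarriers15) :
    datumOfRecord₁₃Sep F N (θ.pinW F N W₀) (h.pinW W₀) = datumOfRecord₁₃Sep F N θ h := rfl

/-- … the [B8] pin (`rfl`) … [cite: Balaban1989LargeFieldII, Thm 1 + (0.1) pp.355–356 (bookkeeping)] -/
theorem datumOfRecord₁₃Sep_pinB8 (θ : Stage13Params F N) (h : θ.Provisos₁₃Sep F N) (lam : ResidB8 θ.toStage3Params) :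
    datumOfRecord₁₃Sep F N (θ.pinB8 F N lam) (h.pinB8 lam) = datumOfRecord₁₃Sep F N θ h :=
  datumOfRecord₁₃Sep_rebindX F N θ h _ (h.pinB8 lam)

/-- … the [B12] pin (`rfl`) … [cite: Balaban1989LargeFieldII, Thm 1 + (0.1) pp.355–356 (bookkeeping)] -/
theorem datumOfRecord₁₃Sep_pinB12 (θ : Stage13Params F N) (h : θ.Provisos₁₃Sep F N) (lam : ResidB12 F N θ.τ9.M) :
    datumOfRecord₁₃Sep F N (θ.pinB12 F N lam) (h.pinB12 lam) = datumOfRecord₁₃Sep F N θ h :=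
  datumOfRecord₁₃Sep_rebindX F N θ h _ (h.pinB12 lam)

/-- … the [B8′] pin (`rfl`) … [cite: Balaban1989LargeFieldII, Thm 1 + (0.1) pp.355–356 (bookkeeping)] -/
theorem datumOfRecord₁₃Sep_pinB8Sub (θ : Stage13Params F N) (h : θ.Provisos₁₃Sep F N) (lam : ResidB8 θ.toStage3Params) :
    datumOfRecord₁₃Sep F N (θ.pinB8Sub F N lam) (h.pinB8Sub lam) = datumOfRecord₁₃Sep F N θ h :=
  datumOfRecord₁₃Sep_rebindX F N θ h _ (h.pinB8Sub lam)

/-- … the [B13] pin (`rfl`) … [cite: Balaban1989LargeFieldII, Thm 1 + (0.1) pp.355–356; Balaban1988RG2Cluster, Lemmas 1–3 pp.9–20 (bookkeeping)] -/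
theorem datumOfRecord₁₃Sep_pinB13 (θ : Stage13Params F N) (h : θ.Provisos₁₃Sep F N) (lam : B12.RunParams → ResidB13 θ.toStage3Params) :
    datumOfRecord₁₃Sep F N (θ.pinB13 F N lam) (h.pinB13 lam) = datumOfRecord₁₃Sep F N θ h :=
  datumOfRecord₁₃Sep_rebindX F N θ h _ (h.pinB13 lam)

/-- … and the one-level X-pin (`rfl`). [cite: Balaban1989LargeFieldII, Thm 1 + (0.1) pp.355–356 (bookkeeping)] -/
theorem datumOfRecord₁₃Sep_pinX3 (θ : Stage13Params F N) (h : θ.Provisos₁₃Sep F N) (lam8 : ResidB8 θ.toStage3Params) (lam12 : ResidB12 F N θ.τ9.M)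
    (lam13 : B12.RunParams → ResidB13 θ.toStage3Params) :
    datumOfRecord₁₃Sep F N (θ.pinX3 F N lam8 lam12 lam13) (h.pinX3 lam8 lam12 lam13) = datumOfRecord₁₃Sep F N θ h :=
  datumOfRecord₁₃Sep_rebindX F N θ h _ (h.pinX3 lam8 lam12 lam13)

end Sep

/-! ## §3. The v1.2 record `IsRecordOfRecord₁₃CSep` presented at a re-bound ∕ pinned Stage-13 view (same datum, `datumOfRecord₁₃Sep_rebindX`) -/

section Records

variable (F N)

/-- **Pointed form, generic re-binding, v1.2 vocabulary**: a world with def-T's pointed clauses — construction `(datumOfRecord₁₃Sep θ h).C`, window `0 < w.γ ≤ θ.γ`, block size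
`θ.L` — whose upstream blocks are the C-binding over the Stage-13 view of the RE-BOUND parameters IS a v1.2 ₁₃C record at `datumOfRecord₁₃Sep θ h` (presenting parameter
`θ.rebindX X'`). [cite: Balaban1989LargeFieldII, Thm 1 + (0.1) pp.355–356 (bookkeeping)] -/
theorem isRecordOfRecord₁₃CSep_rebindX_of_eq (θ : Stage13Params F N) (h : θ.Provisos₁₃Sep F N) (hθ : θ.Admissible F N) (X' : B12.RunParams → PrintedCarriersR)
    (w : WorldP) (hC : w.C = (datumOfRecord₁₃Sep F N θ h).C) (hγ : 0 < w.γ ∧ w.γ ≤ θ.γ) (hL : w.L = (θ.L : ℝ))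
    (hup : ∀ P, w.up P = upOfRecord₅C F N ((θ.rebindX F N X').toStage5₁₃ F N) P) :
    IsRecordOfRecord₁₃CSep F N (datumOfRecord₁₃Sep F N θ h) w :=
  ⟨θ.rebindX F N X', h.rebindX X', (Stage13Params.rebindX_admissible_iff F N θ X').2 hθ, (datumOfRecord₁₃Sep_rebindX F N θ h X' (h.rebindX X')).symm,
    hC, hγ, hL, hup⟩

/-- **EVERY admissible Stage-13 parameter with the v1.2 provisos presents a v1.2 ₁₃C record at its own datum whose world is bound over ANY re-bound Stage-13 view**, any
window `0 < γw ≤ θ.γ`, block size `θ.L`. [cite: Balaban1989LargeFieldII, Thm 1 + (0.1) pp.355–356 (bookkeeping)] -/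
theorem exists_world_isRecordOfRecord₁₃CSep_rebindX (θ : Stage13Params F N) (h : θ.Provisos₁₃Sep F N) (hθ : θ.Admissible F N) (X' : B12.RunParams → PrintedCarriersR)
    {γw : ℝ} (hγw : 0 < γw ∧ γw ≤ θ.γ) :
    ∃ w : WorldP, IsRecordOfRecord₁₃CSep F N (datumOfRecord₁₃Sep F N θ h) w ∧ w.γ = γw ∧ w.L = (θ.L : ℝ) ∧
      ∀ P, w.up P = upOfRecord₅C F N ((θ.rebindX F N X').toStage5₁₃ F N) P := by
  obtain ⟨w₀⟩ := nonempty_worldP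
  exact ⟨{ w₀ with
      C := (datumOfRecord₁₃Sep F N θ h).C, γ := γw, L := (θ.L : ℝ), one_lt_L := by exact_mod_cast θ.hL.2,
      up := fun P => upOfRecord₅C F N ((θ.rebindX F N X').toStage5₁₃ F N) P },
    isRecordOfRecord₁₃CSep_rebindX_of_eq F N θ h hθ X' _ rfl hγw rfl (fun _ => rfl), rfl, rfl, fun _ => rfl⟩

/-- The [B10] instance (dag-n08-c's N08 ₁₃ storeys read it by name). [cite: Balaban1989LargeFieldII, Thm 1 + (0.1) pp.355–356; Balaban1985UV3, Thm 1 p.257 (bookkeeping)] -/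
theorem isRecordOfRecord₁₃CSep_pinB10_of_eq (θ : Stage13Params F N) (h : θ.Provisos₁₃Sep F N) (hθ : θ.Admissible F N)
    (w : WorldP) (hC : w.C = (datumOfRecord₁₃Sep F N θ h).C) (hγ : 0 < w.γ ∧ w.γ ≤ θ.γ) (hL : w.L = (θ.L : ℝ))
    (hup : ∀ P, w.up P = upOfRecord₅C F N ((θ.pinB10 F N).toStage5₁₃ F N) P) :
    IsRecordOfRecord₁₃CSep F N (datumOfRecord₁₃Sep F N θ h) w :=
  isRecordOfRecord₁₃CSep_rebindX_of_eq F N θ h hθ _ w hC hγ hL hup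

/-- The [B13] instance (this seat's N10 ₁₃ storeys read it by name). [cite: Balaban1989LargeFieldII, Thm 1 + (0.1) pp.355–356; Balaban1988RG2Cluster, Lemmas 1–3 pp.9–20 (bookkeeping)] -/
theorem isRecordOfRecord₁₃CSep_pinB13_of_eq (θ : Stage13Params F N) (h : θ.Provisos₁₃Sep F N) (hθ : θ.Admissible F N)
    (lam : B12.RunParams → ResidB13 θ.toStage3Params) (w : WorldP) (hC : w.C = (datumOfRecord₁₃Sep F N θ h).C) (hγ : 0 < w.γ ∧ w.γ ≤ θ.γ) (hL : w.L = (θ.L : ℝ))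
    (hup : ∀ P, w.up P = upOfRecord₅C F N ((θ.pinB13 F N lam).toStage5₁₃ F N) P) :
    IsRecordOfRecord₁₃CSep F N (datumOfRecord₁₃Sep F N θ h) w :=
  isRecordOfRecord₁₃CSep_rebindX_of_eq F N θ h hθ _ w hC hγ hL hup

/-- The X-pinned instance (dag-n24-c's K1 engine closers read it by name). [cite: Balaban1989LargeFieldII, Thm 1 + (0.1) pp.355–356 (bookkeeping)] -/
theorem isRecordOfRecord₁₃CSep_pinX3_of_eq (θ : Stage13Params F N) (h : θ.Provisos₁₃Sep F N) (hθ : θ.Admissible F N) (lam8 : ResidB8 θ.toStage3Params)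
    (lam12 : ResidB12 F N θ.τ9.M) (lam13 : B12.RunParams → ResidB13 θ.toStage3Params) (w : WorldP) (hC : w.C = (datumOfRecord₁₃Sep F N θ h).C)
    (hγ : 0 < w.γ ∧ w.γ ≤ θ.γ) (hL : w.L = (θ.L : ℝ)) (hup : ∀ P, w.up P = upOfRecord₅C F N ((θ.pinX3 F N lam8 lam12 lam13).toStage5₁₃ F N) P) :
    IsRecordOfRecord₁₃CSep F N (datumOfRecord₁₃Sep F N θ h) w :=
  isRecordOfRecord₁₃CSep_rebindX_of_eq F N θ h hθ _ w hC hγ hL hup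

/-- Every admissible Stage-13 parameter with the v1.2 provisos presents a v1.2 ₁₃C record of its own datum over the X-pinned Stage-13 view, any window `0 < γw ≤ θ.γ`,
block size `θ.L`. [cite: Balaban1989LargeFieldII, Thm 1 + (0.1) pp.355–356 (bookkeeping)] -/
theorem exists_world_isRecordOfRecord₁₃CSep_pinX3 (θ : Stage13Params F N) (h : θ.Provisos₁₃Sep F N) (hθ : θ.Admissible F N) (lam8 : ResidB8 θ.toStage3Params)
    (lam12 : ResidB12 F N θ.τ9.M) (lam13 : B12.RunParams → ResidB13 θ.toStage3Params) {γw : ℝ} (hγw : 0 < γw ∧ γw ≤ θ.γ) :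
    ∃ w : WorldP, IsRecordOfRecord₁₃CSep F N (datumOfRecord₁₃Sep F N θ h) w ∧ w.γ = γw ∧ w.L = (θ.L : ℝ) ∧
      ∀ P, w.up P = upOfRecord₅C F N ((θ.pinX3 F N lam8 lam12 lam13).toStage5₁₃ F N) P :=
  exists_world_isRecordOfRecord₁₃CSep_rebindX F N θ h hθ _ hγw

/-- **Every v1.1-keyed presentation is a v1.2 one along `Provisos₁₃.toSep`** (same datum, `datumOfRecord₁₃Sep_toSep`): the ‴-keyed re-bound record lemma of
`Record13Carriers` §3 read in the v1.2 vocabulary. [cite: Balaban1989LargeFieldII, Thm 1 + (0.1) pp.355–356 (bookkeeping)] -/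
theorem isRecordOfRecord₁₃CSep_rebindX_of_eq_toSep (θ : Stage13Params F N) (h : θ.Provisos₁₃ F N) (hθ : θ.Admissible F N) (X' : B12.RunParams → PrintedCarriersR)
    (w : WorldP) (hC : w.C = (datumOfRecord₁₃ F N θ h).C) (hγ : 0 < w.γ ∧ w.γ ≤ θ.γ) (hL : w.L = (θ.L : ℝ))
    (hup : ∀ P, w.up P = upOfRecord₅C F N ((θ.rebindX F N X').toStage5₁₃ F N) P) :
    IsRecordOfRecord₁₃CSep F N (datumOfRecord₁₃Sep F N θ h.toSep) w :=
  isRecordOfRecord₁₃CSep_rebindX_of_eq F N θ h.toSep hθ X' w hC hγ hL hup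

end Records

end Literature.MathematicalPhysics.QuantumFieldTheory.Balaban1983to89.Node00

end
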